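import Summits.SmoothPoincare4.SmoothPoincare4.Theorems.EntropyRungConicalGapStubWeightedIdentity
import Summits.SmoothPoincare4.SmoothPoincare4.Theorems.EntropyRungConicalGapStubWeightedIntegrability
import Summits.SmoothPoincare4.SmoothPoincare4.Theorems.EntropyRungConicalGapSelfSimilarEntropy
import Summits.SmoothPoincare4.SmoothPoincare4.Theorems.EntropyRungConicalGapWeightedMassContinuity
import Summits.SmoothPoincare4.SmoothPoincare4.Theorems.EntropyRungConicalGapLogTransform
import Summits.SmoothPoincare4.SmoothPoincare4.Theorems.EntropyRungConicalGapTransformIterated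
import HarnessLib

/-!
# The exact log-transform and the UNCONDITIONAL half-sup fence `Θ ≤ a·e^{σ/2}`
# (line `Sketch` of crux `EntropyRung.ConicalGap`, stmt-SmoothPoincare4-16589; lead seat c3, cycle 3)

On a complete connected normalised 4-d gradient shrinking Ricci soliton write, for a scale `τ > 0`,

  `Z(τ) = ∫ e^{-f/τ} dV`,  `N(τ) = ∫ R e^{-f/τ} dV`,  `⟨R⟩_τ = N(τ)/Z(τ)`,  `m(τ) = τ ⟨R⟩_τ`,
  `H(T) = T⁻² Z(T)`  (so `(16π²)⁻¹ H(T) = h(T) → a`, the regularised asymptotic volume ratio).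

The finite Wang–Wang density transform of the line (arXiv:2308.06560, Prop. 2.6; landed stubs
`stub_transformFinite`, iterated form `helper_transformFinite_iterated`) is the integrated ODE
`H′(T) = −(T − 1) T⁻⁴ N(T)`, i.e. `(log H)′ = −(1 − 1/T) T⁻² m(T)`. Integrating it EXACTLY in
logarithmic form (`helper_logTransform`, one-sided FTC; continuity of `Z, N` in the scale by dominated
convergence, `helper_weightedMass_continuousOn`) gives, for every `T ≥ 1`,

  `log ∫ e^{-f} dV = log (T⁻² ∫ e^{-f/T} dV) + ∫₁ᵀ (τ − 1) τ⁻² ⟨R⟩_τ dτ`   (`helper_logDensity_eq_transform`)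

— the entropy-side twin of the line's linear identity `∫ e^{-f} = 16π² a + ∫ R k(f)`. Since
`∫₁^∞ (1 − 1/τ) τ⁻² dτ = 1/2`, a bound `m(τ) ≤ σ` on `[1, ∞)` yields, letting `T → ∞`,

  `∫ e^{-f} dV ≤ 16π² · a · e^{σ/2}`,  i.e.  `Θ ≤ a · exp (½ sup_{τ ≥ 1} τ⟨R⟩_τ)`   (`helper_density_le_avr_mul_exp_halfSup`),

with NO appeal to the Li–Wang optimal log-Sobolev constant (the conditional fence of
`EntropyRungConicalGapConeFence.lean` is `Θ ≤ a e^{ρ}`, `ρ = lim m`): whenever `sup m ≤ 2ρ` — in particular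
whenever the cone-excess profile `m` is non-decreasing (`halfSup_density_le_of_monotone`; true on `S⁴`,
`S³×ℝ`, `S²×ℝ²`, the Gaussian, and on FIK where `m(τ) = (2√2 − 2)τ/(τ + √2)`) — the new fence is the
SQUARE ROOT of the old one relative to `a`. Consequently the crux `ConicalGap` holds, unconditionally, for
every shrinker of its class with `16π² a e^{σ/2} ≤ 32π²√π e^{-3/2}` (`helper_conicalGap_of_halfSupFence`);
FIK-type data (`a = 1/2`, `σ = ρ = 2√2 − 2`: `a e^{σ/2} = .757 < .791`) lie inside this sub-class, which the
conditional fence (`a e^{ρ} = 1.145`) did not reach.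

Everything here is proved; no definition and no named fact is introduced or assumed.

## References

* Y. Wang, G. Wang (Wang–Wang 2023), arXiv:2308.06560, Prop. 2.6, (2.6)–(2.10) (the transform, `h`, `a`).
* [CarrilloNi2009] J. Carrillo, L. Ni, Comm. Anal. Geom. 17 (2009) 721–753, §2, §4 (weighted identities).
-/

noncomputable section

-- `Summit.SmoothPoincare4.SmoothPoincare4.…` (summit = problem) trips `dupNamespace` on every decl.
set_option linter.dupNamespace false

open scoped Manifold ContDiff ENNReal NNReal Topology
open MeasureTheory Set Filter
open Literature.Geometry.Lorentzian Literature.Geometry.Riemannian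

namespace Summit.SmoothPoincare4.SmoothPoincare4.Theorems.ConicalGapSketch

namespace HalfSup

variable {M : Type} [TopologicalSpace M] [T2Space M] [SecondCountableTopology M]
  [ChartedSpace (EuclideanSpace ℝ (Fin 4)) M] [IsManifold (𝓡 4) ∞ M] [ConnectedSpace M]
  [T3Space M] [MeasurableSpace M] [BorelSpace M]

/-- **The data of the transform on a complete 4-d shrinker** (over `g.riemVolume`): `R ≥ 0`, `f ≥ 0`,
the three weights integrable at every scale, the weighted identity at every scale, σ-finiteness of `dV`,
continuity of `Z` and `N` on `(0, ∞)`, positivity of `Z`, and the finite transform in iterated form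
`Z(1) = T⁻² Z(T) + ∫₁ᵀ (τ − 1) τ⁻⁴ N(τ) dτ` for every `T ≥ 1`. -/
theorem transformData
    (g : PseudoRiemannianMetric (𝓡 4) ∞ (EuclideanSpace ℝ (Fin 4)) (TangentSpace (𝓡 4) : M → Type _))
    [g.HasLeviCivita] (f : M → ℝ) (hg : g.IsRiemannian)
    (hc : ∀ (x : M) (r : NNReal), IsCompact {y : M | g.edist hg x y ≤ r})
    (hf : ContMDiff (𝓡 4) 𝓘(ℝ, ℝ) ∞ f)
    (hsol : ∀ (x : M) (X Y : TangentSpace (𝓡 4) x),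
      g.ricci x X Y + g.hessian f x X Y = (1 / 2 : ℝ) * g.val x X Y)
    (hnorm : ∀ x : M, g.scalarCurvature x + g.gradSq f x = f x) :
    (∀ x, 0 ≤ g.scalarCurvature x) ∧
    (∀ τ : ℝ, 0 < τ → 0 < ∫ x, Real.exp (-f x / τ) ∂g.riemVolume) ∧
    ContinuousOn (fun τ : ℝ ↦ ∫ x, Real.exp (-f x / τ) ∂g.riemVolume) (Ioi 0) ∧
    ContinuousOn (fun τ : ℝ ↦ ∫ x, g.scalarCurvature x * Real.exp (-f x / τ) ∂g.riemVolume) (Ioi 0) ∧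
    (∀ T : ℝ, 1 ≤ T → ∫ x, Real.exp (-f x) ∂g.riemVolume =
      (T ^ 2)⁻¹ * (∫ x, Real.exp (-f x / T) ∂g.riemVolume) +
        ∫ τ in (1 : ℝ)..T, (τ - 1) / τ ^ 4 *
          ∫ x, g.scalarCurvature x * Real.exp (-f x / τ) ∂g.riemVolume) := by
  obtain ⟨hR0, -, hprop⟩ :=
    NoncompactShrinkerGapCarrilloNiClauses.scalarCurvature_nonneg_and_isCompact_sublevel g f hg hc hf
      hsol hnorm
  have hf0 : ∀ x, 0 ≤ f x := fun x ↦ by linarith [hnorm x, hR0 x, g.gradSq_nonneg hg f x]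
  have hRc : Continuous fun x ↦ g.scalarCurvature x :=
    (PseudoRiemannianMetric.contMDiff_scalarCurvature g).continuous
  -- the three weights are integrable at every scale, and the weighted identity holds at every scale
  have hint : ∀ τ : ℝ, 0 < τ → Integrable (fun x ↦ Real.exp (-f x / τ)) g.riemVolume ∧
      Integrable (fun x ↦ f x * Real.exp (-f x / τ)) g.riemVolume ∧
      Integrable (fun x ↦ g.scalarCurvature x * Real.exp (-f x / τ)) g.riemVolume := fun τ hτ ↦
    weightedIntegrability_riemVolume hg hf hsol hnorm hprop hR0 hτ
  have hid : ∀ τ : ℝ, 0 < τ → ∫ x, (f x - 2 * τ) * Real.exp (-f x / τ) ∂g.riemVolume =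
      (1 - τ) * ∫ x, g.scalarCurvature x * Real.exp (-f x / τ) ∂g.riemVolume := fun τ hτ ↦ by
    obtain ⟨hA, hB, hC⟩ := hint τ hτ
    exact weightedIdentity_riemVolume g f hg hc hf hsol hnorm hτ.ne' hA hB hC
  -- σ-finiteness of `dV`
  haveI : LocallyCompactSpace M := Manifold.locallyCompact_of_finiteDimensional (M := M) (𝓡 4)
  haveI : IsFiniteMeasureOnCompacts g.riemVolume :=
    CarrilloNi2009_shrinkerLSI.isFiniteMeasureOnCompacts_riemVolume hg
  haveI : IsLocallyFiniteMeasure g.riemVolume := isLocallyFiniteMeasure_of_isFiniteMeasureOnCompacts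
  haveI : SigmaFinite g.riemVolume := by infer_instance
  -- continuity in the scale (dominated convergence) and the iterated finite transform (Fubini)
  obtain ⟨hZc, -, hNc⟩ := helper_weightedMass_continuousOn M g.riemVolume f
    (fun x ↦ g.scalarCurvature x) hf.continuous.measurable hRc.measurable hf0 hR0 hint
  have htr := helper_transformFinite_iterated M g.riemVolume f (fun x ↦ g.scalarCurvature x)
    hf.continuous hRc hf0 hR0 hint hid
  exact ⟨hR0, fun τ hτ ↦ selfSimilar_weight_pos g f hg τ (hint τ hτ).1, hZc, hNc, htr⟩

/-- **The exact log-transform** (over `g.riemVolume`): on a complete connected normalised 4-d shrinker,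
for every `T ≥ 1`,
`log ∫ e^{-f} dV = log (T⁻² ∫ e^{-f/T} dV) + ∫₁ᵀ (τ − 1) τ⁻² · (∫ R e^{-f/τ} dV)/(∫ e^{-f/τ} dV) dτ`.
The Wang–Wang ODE `(T⁻² Z(T))′ = −(T − 1) T⁻⁴ N(T)` integrated in logarithmic form
(`helper_logTransform` applied to `H(T) = T⁻² Z(T)`, `N`). -/
theorem logDensity_eq
    (g : PseudoRiemannianMetric (𝓡 4) ∞ (EuclideanSpace ℝ (Fin 4)) (TangentSpace (𝓡 4) : M → Type _))
    [g.HasLeviCivita] (f : M → ℝ) (hg : g.IsRiemannian)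
    (hc : ∀ (x : M) (r : NNReal), IsCompact {y : M | g.edist hg x y ≤ r})
    (hf : ContMDiff (𝓡 4) 𝓘(ℝ, ℝ) ∞ f)
    (hsol : ∀ (x : M) (X Y : TangentSpace (𝓡 4) x),
      g.ricci x X Y + g.hessian f x X Y = (1 / 2 : ℝ) * g.val x X Y)
    (hnorm : ∀ x : M, g.scalarCurvature x + g.gradSq f x = f x) {T : ℝ} (hT : 1 ≤ T) :
    Real.log (∫ x, Real.exp (-f x) ∂g.riemVolume) =
      Real.log ((T ^ 2)⁻¹ * ∫ x, Real.exp (-f x / T) ∂g.riemVolume) +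
        ∫ τ in (1 : ℝ)..T, (τ - 1) / τ ^ 2 *
          ((∫ x, g.scalarCurvature x * Real.exp (-f x / τ) ∂g.riemVolume) /
            (∫ x, Real.exp (-f x / τ) ∂g.riemVolume)) := by
  obtain ⟨-, hZpos, hZc, hNc, htr⟩ := transformData g f hg hc hf hsol hnorm
  set Z : ℝ → ℝ := fun τ ↦ ∫ x, Real.exp (-f x / τ) ∂g.riemVolume with hZdef
  set N : ℝ → ℝ := fun τ ↦ ∫ x, g.scalarCurvature x * Real.exp (-f x / τ) ∂g.riemVolume with hNdef
  set H : ℝ → ℝ := fun τ ↦ (τ ^ 2)⁻¹ * Z τ with hHdef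
  -- hypotheses of `helper_logTransform`
  have hHc : ContinuousOn H (Ioi 0) := by
    refine ContinuousOn.mul (continuousOn_of_forall_continuousAt fun τ hτ ↦ ?_) hZc
    have hτ0 : τ ≠ 0 := (show (0 : ℝ) < τ from hτ).ne'
    fun_prop (disch := positivity)
  have hHpos : ∀ τ : ℝ, 1 ≤ τ → 0 < H τ := fun τ hτ ↦ by
    have hτ0 : 0 < τ := one_pos.trans_le hτ
    exact mul_pos (by positivity) (hZpos τ hτ0)
  have hH1 : H 1 = ∫ x, Real.exp (-f x) ∂g.riemVolume := by
    simp only [hHdef, hZdef, one_pow, inv_one, one_mul, div_one]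
  have htrans : ∀ τ : ℝ, 1 ≤ τ → H 1 = H τ + ∫ s in (1 : ℝ)..τ, (s - 1) / s ^ 4 * N s :=
    fun τ hτ ↦ by rw [hH1]; exact htr τ hτ
  have hlog := helper_logTransform H N hHc hNc hHpos htrans T hT
  rw [hH1] at hlog
  rw [hlog]
  congr 1
  refine intervalIntegral.integral_congr fun τ hτ ↦ ?_
  rw [uIcc_of_le hT] at hτ
  have hτ0 : τ ≠ 0 := (one_pos.trans_le hτ.1).ne'
  have hZτ : (∫ x, Real.exp (-f x / τ) ∂g.riemVolume) ≠ 0 := (hZpos τ (one_pos.trans_le hτ.1)).ne'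
  simp only [hHdef, hNdef, hZdef]
  have key : ∀ A B : ℝ, B ≠ 0 →
      (τ - 1) / τ ^ 4 * A / ((τ ^ 2)⁻¹ * B) = (τ - 1) / τ ^ 2 * (A / B) := fun A B hB ↦ by
    field_simp
  exact key _ _ hZτ

/-- **The half-sup fence at a finite scale** (over `g.riemVolume`): if `τ ⟨R⟩_τ ≤ σ` for all `τ ≥ 1`, then
for every `T ≥ 1`, `∫ e^{-f} dV ≤ T⁻² ∫ e^{-f/T} dV · exp ((σ/2)(1 − T⁻¹)²)`
(`helper_logTransform_le`). -/
theorem density_le_finite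
    (g : PseudoRiemannianMetric (𝓡 4) ∞ (EuclideanSpace ℝ (Fin 4)) (TangentSpace (𝓡 4) : M → Type _))
    [g.HasLeviCivita] (f : M → ℝ) (hg : g.IsRiemannian)
    (hc : ∀ (x : M) (r : NNReal), IsCompact {y : M | g.edist hg x y ≤ r})
    (hf : ContMDiff (𝓡 4) 𝓘(ℝ, ℝ) ∞ f)
    (hsol : ∀ (x : M) (X Y : TangentSpace (𝓡 4) x),
      g.ricci x X Y + g.hessian f x X Y = (1 / 2 : ℝ) * g.val x X Y)
    (hnorm : ∀ x : M, g.scalarCurvature x + g.gradSq f x = f x) {σ : ℝ}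
    (hσ : ∀ τ : ℝ, 1 ≤ τ → τ * ((∫ x, g.scalarCurvature x * Real.exp (-f x / τ) ∂g.riemVolume) /
      (∫ x, Real.exp (-f x / τ) ∂g.riemVolume)) ≤ σ) {T : ℝ} (hT : 1 ≤ T) :
    ∫ x, Real.exp (-f x) ∂g.riemVolume ≤
      (T ^ 2)⁻¹ * (∫ x, Real.exp (-f x / T) ∂g.riemVolume) * Real.exp (σ / 2 * (1 - T⁻¹) ^ 2) := by
  obtain ⟨hR0, hZpos, hZc, hNc, htr⟩ := transformData g f hg hc hf hsol hnorm
  set Z : ℝ → ℝ := fun τ ↦ ∫ x, Real.exp (-f x / τ) ∂g.riemVolume with hZdef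
  set N : ℝ → ℝ := fun τ ↦ ∫ x, g.scalarCurvature x * Real.exp (-f x / τ) ∂g.riemVolume with hNdef
  set H : ℝ → ℝ := fun τ ↦ (τ ^ 2)⁻¹ * Z τ with hHdef
  have hHc : ContinuousOn H (Ioi 0) := by
    refine ContinuousOn.mul (continuousOn_of_forall_continuousAt fun τ hτ ↦ ?_) hZc
    have hτ0 : τ ≠ 0 := (show (0 : ℝ) < τ from hτ).ne'
    fun_prop (disch := positivity)
  have hHpos : ∀ τ : ℝ, 1 ≤ τ → 0 < H τ := fun τ hτ ↦ by
    have hτ0 : 0 < τ := one_pos.trans_le hτ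
    exact mul_pos (by positivity) (hZpos τ hτ0)
  have hN0 : ∀ τ : ℝ, 1 ≤ τ → 0 ≤ N τ := fun τ _ ↦
    integral_nonneg fun x ↦ mul_nonneg (hR0 x) (Real.exp_pos _).le
  have hH1 : H 1 = ∫ x, Real.exp (-f x) ∂g.riemVolume := by
    simp only [hHdef, hZdef, one_pow, inv_one, one_mul, div_one]
  have htrans : ∀ τ : ℝ, 1 ≤ τ → H 1 = H τ + ∫ s in (1 : ℝ)..τ, (s - 1) / s ^ 4 * N s :=
    fun τ hτ ↦ by rw [hH1]; exact htr τ hτ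
  -- the cone bound `N ≤ σ τ H`, i.e. `τ ⟨R⟩_τ ≤ σ`
  have hcone : ∀ τ : ℝ, 1 ≤ τ → N τ ≤ σ * (τ * H τ) := fun τ hτ ↦ by
    have hτ0 : 0 < τ := one_pos.trans_le hτ
    have hZτ : 0 < Z τ := hZpos τ hτ0
    have h' : τ * (N τ / Z τ) ≤ σ := hσ τ hτ
    have key : τ * N τ ≤ σ * Z τ := by
      have h2 := mul_le_mul_of_nonneg_right h' hZτ.le
      rwa [mul_assoc, div_mul_cancel₀ _ hZτ.ne'] at h2
    calc N τ = (τ * N τ) / τ := by field_simp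
      _ ≤ (σ * Z τ) / τ := by gcongr
      _ = σ * (τ * H τ) := by simp only [hHdef]; field_simp
  have hle := helper_logTransform_le H N σ hHc hNc hHpos hN0 htrans hcone T hT
  rw [hH1] at hle
  simpa only [hHdef] using hle

/-- **The half-sup fence `∫ e^{-f} dV ≤ 16π² · a · e^{σ/2}`** (over `g.riemVolume`; UNCONDITIONAL): if the
regularised asymptotic volume ratio `(16π²T²)⁻¹ ∫ e^{-f/T} dV → a` and `τ ⟨R⟩_τ ≤ σ` for all `τ ≥ 1`, then
`Θ ≤ a e^{σ/2}`. (`σ ≥ 0` automatically, from the bound at `τ = 1` and `R ≥ 0`.) -/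
theorem density_le
    (g : PseudoRiemannianMetric (𝓡 4) ∞ (EuclideanSpace ℝ (Fin 4)) (TangentSpace (𝓡 4) : M → Type _))
    [g.HasLeviCivita] (f : M → ℝ) (hg : g.IsRiemannian)
    (hc : ∀ (x : M) (r : NNReal), IsCompact {y : M | g.edist hg x y ≤ r})
    (hf : ContMDiff (𝓡 4) 𝓘(ℝ, ℝ) ∞ f)
    (hsol : ∀ (x : M) (X Y : TangentSpace (𝓡 4) x),
      g.ricci x X Y + g.hessian f x X Y = (1 / 2 : ℝ) * g.val x X Y)
    (hnorm : ∀ x : M, g.scalarCurvature x + g.gradSq f x = f x) {a σ : ℝ}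
    (ha : Tendsto (fun T : ℝ ↦ (16 * Real.pi ^ 2 * T ^ 2)⁻¹ * ∫ x, Real.exp (-f x / T) ∂g.riemVolume)
      atTop (𝓝 a))
    (hσ : ∀ τ : ℝ, 1 ≤ τ → τ * ((∫ x, g.scalarCurvature x * Real.exp (-f x / τ) ∂g.riemVolume) /
      (∫ x, Real.exp (-f x / τ) ∂g.riemVolume)) ≤ σ) :
    ∫ x, Real.exp (-f x) ∂g.riemVolume ≤ 16 * Real.pi ^ 2 * a * Real.exp (σ / 2) := by
  obtain ⟨hR0, hZpos, -, -, -⟩ := transformData g f hg hc hf hsol hnorm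
  -- `σ ≥ 0` from the bound at `τ = 1`
  have hσ0 : 0 ≤ σ := by
    have h1 := hσ 1 le_rfl
    rw [one_mul] at h1
    exact le_trans (div_nonneg (integral_nonneg fun x ↦ mul_nonneg (hR0 x) (Real.exp_pos _).le)
      (hZpos 1 one_pos).le) h1
  -- the right side of the finite fence tends to `16π² a e^{σ/2}`
  have h16 : (0 : ℝ) < 16 * Real.pi ^ 2 := by positivity
  have hH : Tendsto (fun T : ℝ ↦ (T ^ 2)⁻¹ * ∫ x, Real.exp (-f x / T) ∂g.riemVolume) atTop
      (𝓝 (16 * Real.pi ^ 2 * a)) := by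
    have h := ha.const_mul (16 * Real.pi ^ 2)
    refine h.congr' ?_
    filter_upwards [eventually_gt_atTop (0 : ℝ)] with T hT
    field_simp
  have hexp : Tendsto (fun T : ℝ ↦ Real.exp (σ / 2 * (1 - T⁻¹) ^ 2)) atTop (𝓝 (Real.exp (σ / 2))) := by
    have h1 : Tendsto (fun T : ℝ ↦ σ / 2 * (1 - T⁻¹) ^ 2) atTop (𝓝 (σ / 2 * (1 - 0) ^ 2)) :=
      ((tendsto_const_nhds.sub tendsto_inv_atTop_zero).pow 2).const_mul _
    rw [sub_zero, one_pow, mul_one] at h1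
    exact Real.continuous_exp.continuousAt.tendsto.comp h1
  have hlim := hH.mul hexp
  refine (ge_of_tendsto hlim ?_).trans_eq (by ring)
  filter_upwards [eventually_ge_atTop (1 : ℝ)] with T hT
  exact density_le_finite g f hg hc hf hsol hnorm hσ hT

/-- **The half-fence for a non-decreasing cone-excess profile** (over `g.riemVolume`; UNCONDITIONAL): if
`τ ⟨R⟩_τ` is non-decreasing on `[1, ∞)` with limit `ρ`, then `∫ e^{-f} dV ≤ 16π² · a · e^{ρ/2}` — the square
root, relative to `a`, of the conditional cone fence `16π² a e^{ρ}` of `EntropyRungConicalGapConeFence.lean`. -/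
theorem density_le_of_monotone
    (g : PseudoRiemannianMetric (𝓡 4) ∞ (EuclideanSpace ℝ (Fin 4)) (TangentSpace (𝓡 4) : M → Type _))
    [g.HasLeviCivita] (f : M → ℝ) (hg : g.IsRiemannian)
    (hc : ∀ (x : M) (r : NNReal), IsCompact {y : M | g.edist hg x y ≤ r})
    (hf : ContMDiff (𝓡 4) 𝓘(ℝ, ℝ) ∞ f)
    (hsol : ∀ (x : M) (X Y : TangentSpace (𝓡 4) x),
      g.ricci x X Y + g.hessian f x X Y = (1 / 2 : ℝ) * g.val x X Y)
    (hnorm : ∀ x : M, g.scalarCurvature x + g.gradSq f x = f x) {a ρ : ℝ}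
    (ha : Tendsto (fun T : ℝ ↦ (16 * Real.pi ^ 2 * T ^ 2)⁻¹ * ∫ x, Real.exp (-f x / T) ∂g.riemVolume)
      atTop (𝓝 a))
    (hmono : ∀ τ τ' : ℝ, 1 ≤ τ → τ ≤ τ' →
      τ * ((∫ x, g.scalarCurvature x * Real.exp (-f x / τ) ∂g.riemVolume) /
        (∫ x, Real.exp (-f x / τ) ∂g.riemVolume)) ≤
      τ' * ((∫ x, g.scalarCurvature x * Real.exp (-f x / τ') ∂g.riemVolume) /
        (∫ x, Real.exp (-f x / τ') ∂g.riemVolume)))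
    (hρ : Tendsto (fun T : ℝ ↦ T * ((∫ x, g.scalarCurvature x * Real.exp (-f x / T) ∂g.riemVolume) /
      (∫ x, Real.exp (-f x / T) ∂g.riemVolume))) atTop (𝓝 ρ)) :
    ∫ x, Real.exp (-f x) ∂g.riemVolume ≤ 16 * Real.pi ^ 2 * a * Real.exp (ρ / 2) := by
  refine density_le g f hg hc hf hsol hnorm ha fun τ hτ ↦ ?_
  refine ge_of_tendsto hρ ?_
  filter_upwards [eventually_ge_atTop τ] with τ' hτ'
  exact hmono τ τ' hτ hτ'

end HalfSup

/-! ## Registered helpers (crux vocabulary) -/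

/-- **Helper `helper_logDensity_eq_transform` of line `Sketch`** (crux `EntropyRung.ConicalGap`; UNCONDITIONAL —
the exact log-transform, entropy-side twin of `helper_densityTransform`): on every complete connected normalised
4-d gradient shrinking Ricci soliton and for every `T ≥ 1`,
`log ∫ e^{-f} dV = log (T⁻² ∫ e^{-f/T} dV) + ∫₁ᵀ (τ − 1) τ⁻² · (∫ R e^{-f/τ} dV)/(∫ e^{-f/τ} dV) dτ`
(`dV` the Riemannian measure of `g.toContMDiffRiemannianMetric hg`). As `T → ∞` on an asymptotically conical
shrinker: `log Θ − log a = ∫₁^∞ (1 − 1/τ) τ⁻² · τ⟨R⟩_τ dτ` (`∫₁^∞ (1 − 1/τ) τ⁻² dτ = 1/2`). -/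
theorem helper_logDensity_eq_transform : ∀ (M : Type) [TopologicalSpace M] [T2Space M] [SecondCountableTopology M] [ChartedSpace (EuclideanSpace ℝ (Fin 4)) M] [IsManifold (𝓡 4) ∞ M] [ConnectedSpace M] [T3Space M] [MeasurableSpace M] [BorelSpace M] (g : Literature.Geometry.Lorentzian.PseudoRiemannianMetric (𝓡 4) ∞ (EuclideanSpace ℝ (Fin 4)) (TangentSpace (𝓡 4) : M → Type _)) [g.HasLeviCivita] (f : M → ℝ) (hg : g.IsRiemannian), (∀ (x : M) (r : NNReal), IsCompact {y : M | g.edist hg x y ≤ r}) → ContMDiff (𝓡 4) 𝓘(ℝ, ℝ) ∞ f → (∀ (x : M) (X Y : TangentSpace (𝓡 4) x), g.ricci x X Y + g.hessian f x X Y = (1 / 2 : ℝ) * g.val x X Y) → (∀ x : M, g.scalarCurvature x + g.gradSq f x = f x) → ∀ T : ℝ, 1 ≤ T → Real.log (∫ x, Real.exp (-f x) ∂(Literature.Geometry.Lorentzian.riemannianMeasure (g.toContMDiffRiemannianMetric hg))) = Real.log ((T ^ 2)⁻¹ * ∫ x, Real.exp (-f x / T) ∂(Literature.Geometry.Lorentzian.riemannianMeasure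 (g.toContMDiffRiemannianMetric hg))) + ∫ τ in (1 : ℝ)..T, (τ - 1) / τ ^ 2 * ((∫ x, g.scalarCurvature x * Real.exp (-f x / τ) ∂(Literature.Geometry.Lorentzian.riemannianMeasure (g.toContMDiffRiemannianMetric hg))) / (∫ x, Real.exp (-f x / τ) ∂(Literature.Geometry.Lorentzian.riemannianMeasure (g.toContMDiffRiemannianMetric hg)))) := by
  intro M _ _ _ _ _ _ _ _ _ g _ f hg hc hf hsol hnorm T hT
  rw [← PseudoRiemannianMetric.riemVolume_eq hg]
  exact HalfSup.logDensity_eq g f hg hc hf hsol hnorm hT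

/-- **Helper `helper_density_le_avr_mul_exp_halfSup` of line `Sketch` — the HALF-SUP FENCE** (UNCONDITIONAL): on
every complete connected normalised 4-d gradient shrinker, if the regularised asymptotic volume ratio
`(16π²T²)⁻¹ ∫ e^{-f/T} dV → a` (the `a` of `helper_densityTransform`) and the cone-excess profile satisfies
`τ ⟨R⟩_τ ≤ σ` for all `τ ≥ 1`, then `∫ e^{-f} dV ≤ 16π² · a · e^{σ/2}`, i.e. `Θ ≤ AVR · exp (½ sup_{τ≥1} τ⟨R⟩_τ)`.
No named fact is used (compare `helper_density_le_avr_mul_exp`: `Θ ≤ AVR · e^{ρ}`, `ρ = lim τ⟨R⟩_τ`, modulo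
Li–Wang). -/
theorem helper_density_le_avr_mul_exp_halfSup : ∀ (M : Type) [TopologicalSpace M] [T2Space M] [SecondCountableTopology M] [ChartedSpace (EuclideanSpace ℝ (Fin 4)) M] [IsManifold (𝓡 4) ∞ M] [ConnectedSpace M] [T3Space M] [MeasurableSpace M] [BorelSpace M] (g : Literature.Geometry.Lorentzian.PseudoRiemannianMetric (𝓡 4) ∞ (EuclideanSpace ℝ (Fin 4)) (TangentSpace (𝓡 4) : M → Type _)) [g.HasLeviCivita] (f : M → ℝ) (hg : g.IsRiemannian), (∀ (x : M) (r : NNReal), IsCompact {y : M | g.edist hg x y ≤ r}) → ContMDiff (𝓡 4) 𝓘(ℝ, ℝ) ∞ f → (∀ (x : M) (X Y : TangentSpace (𝓡 4) x), g.ricci x X Y + g.hessian f x X Y = (1 / 2 : ℝ) * g.val x X Y) → (∀ x : M, g.scalarCurvature x + g.gradSq f x = f x) → ∀ a σ : ℝ, Filter.Tendsto (fun T : ℝ ↦ (16 * Real.pi ^ 2 * T ^ 2)⁻¹ * ∫ x, Real.exp (-f x / T) ∂(Literature.Geometry.Lorentzian.riemannianMeasure (g.toContMDiffRiemannianMetric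 hg))) Filter.atTop (nhds a) → (∀ τ : ℝ, 1 ≤ τ → τ * ((∫ x, g.scalarCurvature x * Real.exp (-f x / τ) ∂(Literature.Geometry.Lorentzian.riemannianMeasure (g.toContMDiffRiemannianMetric hg))) / (∫ x, Real.exp (-f x / τ) ∂(Literature.Geometry.Lorentzian.riemannianMeasure (g.toContMDiffRiemannianMetric hg)))) ≤ σ) → ∫ x, Real.exp (-f x) ∂(Literature.Geometry.Lorentzian.riemannianMeasure (g.toContMDiffRiemannianMetric hg)) ≤ 16 * Real.pi ^ 2 * a * Real.exp (σ / 2) := by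
  intro M _ _ _ _ _ _ _ _ _ g _ f hg hc hf hsol hnorm a σ ha hσ
  rw [← PseudoRiemannianMetric.riemVolume_eq hg] at ha hσ ⊢
  exact HalfSup.density_le g f hg hc hf hsol hnorm ha hσ

/-- **Helper `helper_conicalGap_of_halfSupFence` of line `Sketch` — the crux on the HALF-SUP-FENCE sub-class**
(UNCONDITIONAL): a shrinker of the crux class (complete connected non-compact non-flat normalised 4-d gradient
shrinker with `R → 0` at infinity) whose regularised AVR `a` and cone-excess bound `σ ≥ sup_{τ≥1} τ⟨R⟩_τ` satisfy
`16π² a e^{σ/2} ≤ 32π²√π e^{-3/2}` (i.e. `AVR · e^{σ/2} ≤ Θ(S³×ℝ) = .791`) satisfies the conclusion of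
`EntropyRung.ConicalGap`. FIK-type data (`a = 1/2`, `σ = 2√2 − 2`, `a e^{σ/2} = .757`) are inside this
sub-class. (Non-flatness, non-compactness and the decay clause are not used.) -/
theorem helper_conicalGap_of_halfSupFence : ∀ (M : Type) [TopologicalSpace M] [T2Space M] [SecondCountableTopology M] [ChartedSpace (EuclideanSpace ℝ (Fin 4)) M] [IsManifold (𝓡 4) ∞ M] [ConnectedSpace M] [NoncompactSpace M] [T3Space M] [MeasurableSpace M] [BorelSpace M] (g : Literature.Geometry.Lorentzian.PseudoRiemannianMetric (𝓡 4) ∞ (EuclideanSpace ℝ (Fin 4)) (TangentSpace (𝓡 4) : M → Type _)) [g.HasLeviCivita] (f : M → ℝ) (hg : g.IsRiemannian), (∀ (x : M) (r : NNReal), IsCompact {y : M | g.edist hg x y ≤ r}) → ContMDiff (𝓡 4) 𝓘(ℝ, ℝ) ∞ f → (∀ (x : M) (X Y : TangentSpace (𝓡 4) x), g.ricci x X Y + g.hessian f x X Y = (1 / 2 : ℝ) * g.val x X Y) → (∀ x : M, g.scalarCurvature x + g.gradSq f x = f x) → (∃ x : M, g.scalarCurvature x ≠ 0) → (∀ ε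 : ℝ, 0 < ε → ∃ K : Set M, IsCompact K ∧ ∀ x, x ∉ K → g.scalarCurvature x < ε) → ∀ a σ : ℝ, Filter.Tendsto (fun T : ℝ ↦ (16 * Real.pi ^ 2 * T ^ 2)⁻¹ * ∫ x, Real.exp (-f x / T) ∂(Literature.Geometry.Lorentzian.riemannianMeasure (g.toContMDiffRiemannianMetric hg))) Filter.atTop (nhds a) → (∀ τ : ℝ, 1 ≤ τ → τ * ((∫ x, g.scalarCurvature x * Real.exp (-f x / τ) ∂(Literature.Geometry.Lorentzian.riemannianMeasure (g.toContMDiffRiemannianMetric hg))) / (∫ x, Real.exp (-f x / τ) ∂(Literature.Geometry.Lorentzian.riemannianMeasure (g.toContMDiffRiemannianMetric hg)))) ≤ σ) → 16 * Real.pi ^ 2 * a * Real.exp (σ / 2) ≤ 32 * Real.pi ^ 2 * Real.sqrt Real.pi * Real.exp (-(3 : ℝ) / 2) → ∫⁻ x, ENNReal.ofReal (Real.exp (-f x)) ∂(Literature.Geometry.Lorentzian.riemannianMeasure (g.toContMDiffRiemannianMetric hg)) ≤ ENNReal.ofReal (32 * Real.pi ^ 2 * Real.sqrt Real.pi * Real.exp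 (-(3 : ℝ) / 2)) := by
  intro M _ _ _ _ _ _ _ _ _ _ g _ f hg hc hf hsol hnorm _ _ a σ ha hσ hbudget
  have hfence := helper_density_le_avr_mul_exp_halfSup M g f hg hc hf hsol hnorm a σ ha hσ
  obtain ⟨hI1, -, -⟩ := stub_weightedIntegrability M g f hg hc hf hsol hnorm 1 one_pos
  have hI1' : Integrable (fun x ↦ Real.exp (-f x))
      (riemannianMeasure (g.toContMDiffRiemannianMetric hg)) := by
    simpa only [div_one] using hI1
  rw [← ofReal_integral_eq_lintegral_ofReal hI1' (ae_of_all _ fun x ↦ (Real.exp_pos _).le)]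
  exact ENNReal.ofReal_le_ofReal (hfence.trans hbudget)

end Summit.SmoothPoincare4.SmoothPoincare4.Theorems.ConicalGapSketch

end
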